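import Summits.ResolutionOfSingularities.ResolutionOfSingularities.Theorems.WildConesCampaignW46ThreefoldsCharTwoSplittingRegime

/-!
# [OURS · L1 W4.6, rung (ii) at p = 2] The infinitely-near double point of an order-2-cleaned threefold
# double point in characteristic two is UNIQUE and sits at the radical of the polar form; `μ = 2` means
# resolved by ONE blow-up, a double successor means `μ ≥ 4` — over EVERY field of characteristic 2

Cell res-hironaka (LADDER-RESOLUTION rung L, D-0089), slot W4.6, seat res-L1-s46-pv-4 (gen 2); host route
`WildCones`, crux `ClassicalRegimes` (stmt-ResolutionOfSingularities-16884). Sequel to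
`…CharTwoSplittingRegime` (closure of the hyperbolic-splitting regime) of the same seat.

HONEST FRAMING. Everything here is OURS: theorems about route WildCones' own typed point-blow-up dynamics
(`Theorems/WildConesClassicalRegimesDefs.lean`: states `c`, `step i τ c` = blow up the closed point, chart
`u_i`, translate by `τ`, clean; `MultP`, `OrdP`, `Isol`, `mu`). It REPLACES THE ROLE of the uniqueness /
determinacy aspect of the procedure of Th. 16.6–16.13 (H. Hironaka, ms. 2017-03-23, p.84, p.87: in the
forced regime the centre is the singular point; here: the NEXT singular point, if any, is unique and
explicitly located) in ONE regime — order-2-cleaned double points `z² = a(u₀,u₁,u₂)` in characteristic `2`.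
NOTHING here is a statement of the manuscript [Hironaka2017]; no FACT-LIST premise. AI review is weaker
than expert review.

* `fin_three_eq_or` — three distinct indices exhaust `Fin 3` (bookkeeping).
* `threefold_nearPoint_formula` — if the successor of a double state `c` in chart `i` at translation `τ` is
  again a double point then, for the two indices `m ≠ l` off the chart, `τ_l · [u_l u_m] a = [u_i u_m] a`:
  the translation is PINNED by the quadratic form `q = Σ_{j<l} q_{jl} u_j u_l` of the cleaned state — the
  near double point is the point `(q_{jl} : q_{il} : q_{ij})` of the exceptional plane, the RADICAL of the
  (alternating) polar form of `q` (`coeff_single_strict` of the tree + vanishing of the linear terms).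
* `threefold_nearPoint_unique` — UNIQUENESS: for an order-2-cleaned double state, two translations in the
  same chart with double-point successors agree off the chart index. The forced procedure is DETERMINISTIC
  in this regime: at most one infinitely-near double point per chart (and, by the formula, the candidates of
  the three charts are the same projective point).
* `threefold_four_le_mu_of_double_successor` / `threefold_no_double_successor_of_mu_eq_two` /
  `threefold_smooth_successors_of_mu_eq_two` — a double successor forces `μ ≥ 4`; an order-2-cleaned
  isolated double point with `μ = 2` (the `A₂`-type bottom of the regime, e.g. `z² = u₀u₁ + u₂³`) is
  RESOLVED BY ONE BLOW-UP along every word: every successor has a linear cleaned monomial.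

References: G.-M. Greuel, G. Pfister, J. Algebra 689 (2026) = arXiv:2507.17078 [GreuelPfister2026]
(through the tree); H. Hironaka, ms. 2017, Th. 16.6 p.84, Th. 16.13 p.87 — quoted for the ROLE replaced
only, under adjudication, not cited as fact.
-/

noncomputable section

-- single-problem summit: the doubled namespace component `ResolutionOfSingularities` is forced
set_option linter.dupNamespace false

open scoped BigOperators Classical

open MvPowerSeries

open Literature.AlgebraicGeometry.Resolution

namespace Summit.ResolutionOfSingularities.ResolutionOfSingularities.Theorems

namespace CampaignW46.ThreefoldsCharTwo

open WildCones WildCones.MuDropCharTwoOrdP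

variable {κ : Type} [Field κ]

/-- Three pairwise distinct indices exhaust `Fin 3`. [folklore] -/
theorem fin_three_eq_or {i j l : Fin 3} (hij : i ≠ j) (hil : i ≠ l) (hjl : j ≠ l) (s : Fin 3) :
    s = i ∨ s = j ∨ s = l := by
  rw [Ne, Fin.ext_iff] at hij hil hjl
  rw [Fin.ext_iff, Fin.ext_iff, Fin.ext_iff]
  omega

/-- [OURS · L1 W4.6 rung (ii) at `p = 2`; NOT a statement of the manuscript] **The near double point is
PINNED by the quadratic form.** Threefold double points `z² = a(u₀,u₁,u₂)` over any field of
characteristic `2`: if a double state `c` (cleaned quadratic form `q = Σ q_{jl} u_j u_l`) has a DOUBLE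
POINT as successor in chart `i` at translation `τ`, then for the two indices `m ≠ l` off the chart
`τ_l · q_{lm} = q_{im}` — the linear coefficient `[u_m]` of the strict transform,
`q_{im} + τ_l q_{lm}` (`coeff_single_strict`; the diagonal term carries the factor `1 + 1 = 0`), must
vanish. [folklore] -/
theorem threefold_nearPoint_formula [CharP κ 2] (c : (Fin 3 → ℕ) → κ) (i : Fin 3) (τ : Fin 3 → κ)
    (hM : MultP 2 3 κ c) (hM' : MultP 2 3 κ (step 2 3 κ i τ c)) {m l : Fin 3} (hm : m ≠ i)
    (hl : l ≠ i) (hml : m ≠ l) :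
    τ l * coeff (Finsupp.single l 1 + Finsupp.single m 1) (ser 2 3 κ c) =
      coeff (Finsupp.single i 1 + Finsupp.single m 1) (ser 2 3 κ c) := by
  have h := coeff_single_strict i τ (two_le_order_ser hM) (X_pow_mul_serT_eq_subst c i τ hM) hm
  rw [coeff_single_serT le_rfl c i τ hM hM' m] at h
  -- the sum over `s ≠ i` has the two terms `s = m` (zero) and `s = l`
  rw [Finset.sum_eq_single_of_mem l (Finset.mem_erase.mpr ⟨hl, Finset.mem_univ l⟩)] at h
  · have h1 : (((Finsupp.single l 1 : Fin 3 →₀ ℕ) m : ℕ) : κ) + 1 = 1 := by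
      simp [Ne.symm hml]
    rw [h1, mul_one] at h
    -- `0 = q_{im} + τ_l q_{lm}` in characteristic two
    exact (CharTwo.add_eq_zero.mp h.symm).symm
  · intro s hs hsl
    have hsi : s ≠ i := Finset.ne_of_mem_erase hs
    rcases fin_three_eq_or (Ne.symm hm) (Ne.symm hl) hml s with rfl | rfl | rfl
    · exact absurd rfl hsi
    · have h0 : (((Finsupp.single s 1 : Fin 3 →₀ ℕ) s : ℕ) : κ) + 1 = 0 := by
        simp only [Finsupp.single_eq_same, Nat.cast_one]
        exact CharTwo.add_self_eq_zero 1
      rw [h0, mul_zero, zero_mul]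
    · exact absurd rfl hsl

/-- [OURS · L1 W4.6 rung (ii) at `p = 2`; NOT a statement of the manuscript] **UNIQUENESS OF THE
INFINITELY-NEAR DOUBLE POINT** (threefold double points, any field of characteristic `2`): for an
order-2-cleaned double state `c`, if two translations `τ, τ'` in the same chart `i` both have a double
point as successor, they agree off the chart index. With `threefold_nearPoint_formula` the common value is
`τ_l = q_{ij}/q_{jl}`, `τ_j = q_{il}/q_{jl}` for the hyperbolic pair `{j, l}` avoiding `i` — the point
`(q_{jl} : q_{il} : q_{ij})` of the exceptional plane, the same for all three charts. The forced procedure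
is DETERMINISTIC in this regime. [folklore] -/
theorem threefold_nearPoint_unique [CharP κ 2] (c : (Fin 3 → ℕ) → κ) (i : Fin 3) (τ τ' : Fin 3 → κ)
    (hM : MultP 2 3 κ c) (hO : OrdP 2 3 κ c) (hτ : MultP 2 3 κ (step 2 3 κ i τ c))
    (hτ' : MultP 2 3 κ (step 2 3 κ i τ' c)) : ∀ m ≠ i, τ m = τ' m := by
  obtain ⟨j, l, hjl, hj, hl, hq⟩ := exists_pair_ne i τ (two_le_order_ser hM)
    (X_pow_mul_serT_eq_subst c i τ hM) (coeff_single_serT le_rfl c i τ hM hτ)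
    ((ordP_two_iff_exists_pair c).mp hO)
  have hq' : coeff (Finsupp.single l 1 + Finsupp.single j 1) (ser 2 3 κ c) ≠ 0 := by rwa [add_comm]
  -- `τ_l`, `τ'_l` are pinned by `τ_l q_{lj} = q_{ij}`; `τ_j`, `τ'_j` by `τ_j q_{jl} = q_{il}`
  have el := threefold_nearPoint_formula c i τ hM hτ hj hl hjl
  have el' := threefold_nearPoint_formula c i τ' hM hτ' hj hl hjl
  have ej := threefold_nearPoint_formula c i τ hM hτ hl hj (Ne.symm hjl)
  have ej' := threefold_nearPoint_formula c i τ' hM hτ' hl hj (Ne.symm hjl)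
  intro m hm
  rcases fin_three_eq_or (Ne.symm hj) (Ne.symm hl) hjl m with rfl | rfl | rfl
  · exact absurd rfl hm
  · exact mul_right_cancel₀ hq (ej.trans ej'.symm)
  · exact mul_right_cancel₀ hq' (el.trans el'.symm)

/-- [OURS · L1 W4.6 rung (ii) at `p = 2`; NOT a statement of the manuscript] **A double successor forces
`μ ≥ 4`**: over any field of characteristic `2`, if an order-2-cleaned isolated double point of
`z² = a(u₀,u₁,u₂)` has a double point as a point-blow-up successor, its Milnor number is at least `4`
(the successor is again in the regime, with `μ' ≥ 2`, and `μ = μ' + 2`). [folklore] -/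
theorem threefold_four_le_mu_of_double_successor [CharP κ 2] (c : (Fin 3 → ℕ) → κ) (i : Fin 3)
    (τ : Fin 3 → κ) (hM : MultP 2 3 κ c) (hO : OrdP 2 3 κ c) (hI : Isol 2 3 κ c)
    (hM' : MultP 2 3 κ (step 2 3 κ i τ c)) : 4 ≤ mu 2 3 κ c := by
  obtain ⟨hO', hI', hμ⟩ := threefold_regime_step c i τ hM hO hI hM'
  have h2 := threefold_two_le_mu hM' hO' hI'
  omega

/-- [OURS · L1 W4.6 rung (ii) at `p = 2`; NOT a statement of the manuscript] **`μ = 2`: resolved by ONE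
blow-up.** Over any field of characteristic `2`, an order-2-cleaned isolated double point of
`z² = a(u₀,u₁,u₂)` with Milnor number `2` (the bottom of the regime, e.g. `z² = u₀u₁ + u₂³`) has NO double
point among its point-blow-up successors: every chart, every translation leaves multiplicity two.
[folklore] -/
theorem threefold_no_double_successor_of_mu_eq_two [CharP κ 2] (c : (Fin 3 → ℕ) → κ)
    (hM : MultP 2 3 κ c) (hO : OrdP 2 3 κ c) (hI : Isol 2 3 κ c) (hμ : mu 2 3 κ c = 2) (i : Fin 3)
    (τ : Fin 3 → κ) : ¬ MultP 2 3 κ (step 2 3 κ i τ c) := fun hM' => by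
  have := threefold_four_le_mu_of_double_successor c i τ hM hO hI hM'
  omega

/-- [OURS · L1 W4.6 rung (ii) at `p = 2`; NOT a statement of the manuscript] **`μ = 2`: every successor is
a smooth point** — its cleaned series is non-zero (`ser_step_ne_zero_of_ordP`) of multiplicity `< 2`,
hence has a LINEAR monomial. [folklore] -/
theorem threefold_smooth_successors_of_mu_eq_two [CharP κ 2] (c : (Fin 3 → ℕ) → κ)
    (hM : MultP 2 3 κ c) (hO : OrdP 2 3 κ c) (hI : Isol 2 3 κ c) (hμ : mu 2 3 κ c = 2) (i : Fin 3)
    (τ : Fin 3 → κ) :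
    ∃ A, clean 2 3 κ (step 2 3 κ i τ c) A ≠ 0 ∧ Finset.sum Finset.univ (fun j => A j) = 1 :=
  exists_linear_of_not_multP (ser_step_ne_zero_of_ordP c i τ hM hO)
    (threefold_no_double_successor_of_mu_eq_two c hM hO hI hμ i τ)

/-! ## Across charts: the candidates of the three charts are one projective point (appended 2026-08-27) -/

/-- [OURS · L1 W4.6 rung (ii) at `p = 2`; NOT a statement of the manuscript] In the order-2-cleaned regime a
double-point successor in chart `k` forces the quadratic coefficient of the pair AVOIDING `k` to be non-zero
(the pair given by `exists_pair_ne` is that pair, `Fin 3` having only one pair off `k`). [folklore] -/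
theorem threefold_pair_ne_zero_of_double_successor [CharP κ 2] (c : (Fin 3 → ℕ) → κ) (k : Fin 3)
    (σ : Fin 3 → κ) (hM : MultP 2 3 κ c) (hO : OrdP 2 3 κ c) (hσ : MultP 2 3 κ (step 2 3 κ k σ c))
    {a b : Fin 3} (hak : a ≠ k) (hbk : b ≠ k) (hab : a ≠ b) :
    coeff (Finsupp.single a 1 + Finsupp.single b 1) (ser 2 3 κ c) ≠ 0 := by
  obtain ⟨a', b', hab', ha', hb', hq'⟩ := exists_pair_ne k σ (two_le_order_ser hM)
    (X_pow_mul_serT_eq_subst c k σ hM) (coeff_single_serT le_rfl c k σ hM hσ)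
    ((ordP_two_iff_exists_pair c).mp hO)
  rcases fin_three_eq_or (Ne.symm hak) (Ne.symm hbk) hab a' with rfl | rfl | rfl
  · exact absurd rfl ha'
  · rcases fin_three_eq_or (Ne.symm hak) (Ne.symm hbk) hab b' with rfl | rfl | rfl
    · exact absurd rfl hb'
    · exact absurd rfl hab'
    · exact hq'
  · rcases fin_three_eq_or (Ne.symm hak) (Ne.symm hbk) hab b' with rfl | rfl | rfl
    · exact absurd rfl hb'
    · rw [add_comm]; exact hq'
    · exact absurd rfl hab'

/-- [OURS · L1 W4.6 rung (ii) at `p = 2`; NOT a statement of the manuscript] **GLOBAL UNIQUENESS OF THE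
INFINITELY-NEAR DOUBLE POINT, across charts** (threefold double points, any field of characteristic `2`):
if an order-2-cleaned double state `c` has double-point successors in two DIFFERENT charts `i ≠ i'`, at
translations `τ` resp. `τ'`, then the two exceptional points coincide as points of the exceptional plane:
`τ_{i'} · τ'_i = 1` and `τ_m = τ_{i'} · τ'_m` for the third index `m` — `(1 : τ_{i'} : τ_m)` and
`(τ'_i : 1 : τ'_m)` are proportional (both are the radical `(q_{jl} : q_{il} : q_{ij})` of the polar
form, `threefold_nearPoint_formula`). With `threefold_nearPoint_unique` (one candidate per chart): an
order-2-cleaned threefold double point has AT MOST ONE infinitely-near double point altogether. [folklore] -/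
theorem threefold_nearPoint_charts [CharP κ 2] (c : (Fin 3 → ℕ) → κ) {i i' : Fin 3} (hii' : i ≠ i')
    (τ τ' : Fin 3 → κ) (hM : MultP 2 3 κ c) (hO : OrdP 2 3 κ c) (hτ : MultP 2 3 κ (step 2 3 κ i τ c))
    (hτ' : MultP 2 3 κ (step 2 3 κ i' τ' c)) {m : Fin 3} (hmi : m ≠ i) (hmi' : m ≠ i') :
    τ i' * τ' i = 1 ∧ τ m = τ i' * τ' m := by
  have hsymm : ∀ s s' : Fin 3, coeff (Finsupp.single s 1 + Finsupp.single s' 1) (ser 2 3 κ c) =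
      coeff (Finsupp.single s' 1 + Finsupp.single s 1) (ser 2 3 κ c) := fun s s' => by rw [add_comm]
  -- the two pair coefficients `q_{i'm}`, `q_{im}` are non-zero
  have hq1 := threefold_pair_ne_zero_of_double_successor c i τ hM hO hτ (Ne.symm hii') hmi (Ne.symm hmi')
  have hq2 := threefold_pair_ne_zero_of_double_successor c i' τ' hM hO hτ' hii' hmi' (Ne.symm hmi)
  -- the pinning formulas in the two charts
  have f1 := threefold_nearPoint_formula c i τ hM hτ hmi (Ne.symm hii') hmi'
  have f2 := threefold_nearPoint_formula c i τ hM hτ (Ne.symm hii') hmi (Ne.symm hmi')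
  have g1 := threefold_nearPoint_formula c i' τ' hM hτ' hmi' hii' hmi
  have g2 := threefold_nearPoint_formula c i' τ' hM hτ' hii' hmi' (Ne.symm hmi)
  -- f1 : τ i' * q_{i'm} = q_{im};  f2 : τ m * q_{m i'} = q_{i i'}
  -- g1 : τ' i * q_{im} = q_{i'm};  g2 : τ' m * q_{m i} = q_{i' i}
  constructor
  · have h : (τ i' * τ' i) * (coeff (Finsupp.single i' 1 + Finsupp.single m 1) (ser 2 3 κ c) *
        coeff (Finsupp.single i 1 + Finsupp.single m 1) (ser 2 3 κ c)) =
        1 * (coeff (Finsupp.single i' 1 + Finsupp.single m 1) (ser 2 3 κ c) *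
          coeff (Finsupp.single i 1 + Finsupp.single m 1) (ser 2 3 κ c)) := by
      calc (τ i' * τ' i) * (coeff (Finsupp.single i' 1 + Finsupp.single m 1) (ser 2 3 κ c) *
            coeff (Finsupp.single i 1 + Finsupp.single m 1) (ser 2 3 κ c))
          = (τ i' * coeff (Finsupp.single i' 1 + Finsupp.single m 1) (ser 2 3 κ c)) *
              (τ' i * coeff (Finsupp.single i 1 + Finsupp.single m 1) (ser 2 3 κ c)) := by ring
        _ = coeff (Finsupp.single i 1 + Finsupp.single m 1) (ser 2 3 κ c) *
              coeff (Finsupp.single i' 1 + Finsupp.single m 1) (ser 2 3 κ c) := by rw [f1, g1]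
        _ = _ := by ring
    exact mul_right_cancel₀ (mul_ne_zero hq1 hq2) h
  · rw [hsymm m i'] at f2
    rw [hsymm m i, hsymm i' i] at g2
    -- f2 : τ m * q_{i'm} = q_{ii'};  g2 : τ' m * q_{im} = q_{ii'}
    have h : τ m * (coeff (Finsupp.single i' 1 + Finsupp.single m 1) (ser 2 3 κ c) *
        coeff (Finsupp.single i 1 + Finsupp.single m 1) (ser 2 3 κ c)) =
        (τ i' * τ' m) * (coeff (Finsupp.single i' 1 + Finsupp.single m 1) (ser 2 3 κ c) *
          coeff (Finsupp.single i 1 + Finsupp.single m 1) (ser 2 3 κ c)) := by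
      calc τ m * (coeff (Finsupp.single i' 1 + Finsupp.single m 1) (ser 2 3 κ c) *
            coeff (Finsupp.single i 1 + Finsupp.single m 1) (ser 2 3 κ c))
          = (τ m * coeff (Finsupp.single i' 1 + Finsupp.single m 1) (ser 2 3 κ c)) *
              coeff (Finsupp.single i 1 + Finsupp.single m 1) (ser 2 3 κ c) := by ring
        _ = coeff (Finsupp.single i 1 + Finsupp.single i' 1) (ser 2 3 κ c) *
              coeff (Finsupp.single i 1 + Finsupp.single m 1) (ser 2 3 κ c) := by rw [f2]
        _ = (τ' m * coeff (Finsupp.single i 1 + Finsupp.single m 1) (ser 2 3 κ c)) *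
              (τ i' * coeff (Finsupp.single i' 1 + Finsupp.single m 1) (ser 2 3 κ c)) := by
                rw [g2, f1]
        _ = _ := by ring
    exact mul_right_cancel₀ (mul_ne_zero hq1 hq2) h

end CampaignW46.ThreefoldsCharTwo

end Summit.ResolutionOfSingularities.ResolutionOfSingularities.Theorems

end
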